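import Mathlib
import HarnessLib
import Summits.QuantumFields.YangMills.Theorems.MirrorModularBoostsHypercubicLimitSoftFloorsSubseq
import Summits.QuantumFields.YangMills.Theorems.MirrorModularBoostsHypercubicLimitPlaneSumE0E3
import Summits.QuantumFields.YangMills.Theorems.MirrorModularBoostsHypercubicLimitPlaneSumGrowth
import Summits.QuantumFields.YangMills.Theorems.MirrorModularBoostsHypercubicLimitClosureHalvesDefs

/-!
# Line `Sketch` (coupling response), closure step Z3a: the soft legs assembled, modulo translation invariance (corrected form)

Crux `stmt-QuantumFields-16154` (`HypercubicLimit`), line `Sketch`, reshape 5.  Every soft clause of `SoftHalf` for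
`(subseq sch φ hφ, planeSum T)` is now a tree fact along a `PlaneLimits` package — E0-normalisation and E3
(`planeSum_isNormalized_isSymmetric`), E0′ (`planeSum_hasLinearGrowth`), the convergence clause (`convergence_subseq_of_planeLimits`),
non-triviality, non-Gaussianity and the lattice gap (`softFloors_subseq`) — EXCEPT invariance under all translations on `⁰𝒮`, which is
isolated as the residual registered stub (reshape 6: `stub_translationPlanesMono`, WITH `StrictMono φ` — the `φ`-monotonicity-free form of
reshape 5 was false for constant `φ`).  `softLegsPlanes_of_translationMono` is the corrected assembly; the reshape-5 lemma
`softLegsPlanes_of_translation` (same file family) stays as the stronger-hypothesis variant.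
-/

noncomputable section

open scoped SchwartzMap
open MeasureTheory Filter Topology
open Literature.MathematicalPhysics.AQFT Literature.MathematicalPhysics.QuantumLattice
open Literature.MathematicalPhysics.QuantumFieldTheory

namespace Summit.QuantumFields.YangMills.Cruxes.HypercubicLimit.CouplingResponse

/-- **Registered sub-goal `softLegsPlanes_of_translationMono` (Z3a assembled, corrected)**: given translation invariance on `⁰𝒮` of the candidate family
along every `PlaneLimits` package (the residual stub, taken as the first hypothesis in its registered form), the whole soft half of the
one-field clauses holds for `(subseq sch φ hφ, planeSum T)` at every rate `Δ` at which the scheme has a uniform lattice gap. [folklore] -/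
theorem softLegsPlanes_of_translationMono :
    (∀ (G : Type) [Group G] [TopologicalSpace G] [IsTopologicalGroup G] [CompactSpace G] [MeasurableSpace G] [BorelSpace G] (r : LatticeRep G) (sch : SpeciesScheme (YMSpecies G)) (φ : ℕ → ℕ) (hφ : StrictMono φ) (T : (n : ℕ) → (Fin n → Plane) → (𝓢((Fin n → EuclideanSpace ℝ (Fin 4)), ℂ) →L[ℂ] ℂ)), PolyVolume sch → PolyRenorm r sch → UniformFunctionalBoundPlanes r sch → PlaneLimits r sch φ T → ∀ (n : ℕ) (a : EuclideanSpace ℝ (Fin 4)) (F : 𝓢((Fin n → EuclideanSpace ℝ (Fin 4)), ℂ)), IsOffDiagonal F → planeSum T n (translateMulti a F) = planeSum T n F) → ∀ (G : Type) [Group G] [TopologicalSpace G] [IsTopologicalGroup G] [CompactSpace G] [MeasurableSpace G] [BorelSpace G] (r : LatticeRep G) (sch : SpeciesScheme (YMSpecies G)) (φ : ℕ → ℕ) (hφ : StrictMono φ) (T : (n : ℕ) → (Fin n → Plane) → (𝓢((Fin n → EuclideanSpace ℝ (Fin 4)), ℂ) →L[ℂ] ℂ)), sch.HasWeakCouplingLimit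 → PolyVolume sch → PolyRenorm r sch → UniformFunctionalBoundPlanes r sch → IRInputs r sch → PlaneLimits r sch φ T → ∀ Δ : ℝ, 0 < Δ → HasLatticeMassGap r sch Δ → SoftHalf r (subseq sch φ hφ) (planeSum T) Δ := by
  intro htr G _ _ _ _ _ _ r sch φ hφ T _ hpv hpr hUFB hIR hPL Δ _ hgap
  obtain ⟨hE0, hE3⟩ := planeSum_isNormalized_isSymmetric G r sch φ T hPL
  have hE0' := planeSum_hasLinearGrowth G r sch φ T hPL
  obtain ⟨hNT, hNG, hlat⟩ := softFloors_subseq G r sch φ hφ T hPL hIR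
  refine ⟨hE0, hE0', hE3, fun n _ a F hF => ?_, convergence_subseq_of_planeLimits G r sch φ hφ T hPL, hNT, hNG, hlat Δ hgap⟩
  exact htr G r sch φ hφ T hpv hpr hUFB hPL n a F hF

end Summit.QuantumFields.YangMills.Cruxes.HypercubicLimit.CouplingResponse

end
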